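import Literature.MathematicalPhysics.QuantumFieldTheory.Federbush1986.PhaseCellIVThmA3Retract
import Literature.MathematicalPhysics.QuantumFieldTheory.Federbush1986.PuncturedBallMaps

/-!
# `Federbush1986.PhaseCellIVThmA4Retract` — [Federbush1988PhaseCellIV] Appendix A, **Theorem A.4** (A.34)–(A.36) p. 343 with
# the printed continuity of `f^{es} : B − x₀ → M` and the p. 339 «Caution» cap (decl of record `PhaseCellIVAppA.ThmA4ContCap`,
# p251889) — PROVED for every target `M ⊆ R^t` admitting a uniform smooth neighbourhood retract

statement-level skeleton of published theorems with citation tags; proofs where landed; nothing here is a claim about the Yang–Mills mass gap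

CITATION HEADER.  P. Federbush, *A phase cell approach to Yang–Mills theory. IV. The choice of variables*, Commun. Math.
Phys. **114** (1988) 317–343 [Federbush1988PhaseCellIV], Appendix A part D «Geometric Construction 6», Theorem A.4 and its
proof (A.37)–(A.38) p. 343 («follow the construction of subsect. C», i.e. (A.27)–(A.31) p. 342); p. 339 «Caution. The
geometric theorems of Appendix A, require a universal bound on `Λ₁`».  Cell `lit-balaban`, Phase-2 proof seat **p04 gen 7**;
SKELETON row **F4.ThmA.4** (decl of record `PhaseCellIVAppA.ThmA4ContCap` in `PhaseCellIVThmA34Repaired` §3, p251889; fold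
owner r19).  Inputs BY NAME: the smoothing engine `BallSmoothing.smooth` / `BallSmoothing.exists_deriv_bound` (file `BallSmoothingDeriv`) (print's
`f^{s′}_ε`, (A.30)), `PhaseCellIVThmA3Retract` (`norm_iteratedFDeriv_comp_le_of_scale`, the `Pr_M` step (A.31)),
`PuncturedBallMaps` (`radExt` = the integrand `f((y − x₀)/|y − x₀| + x₀)` of (A.38), `fold`, `lipschitzWith_sInf`).

WHAT IS PRINTED (p. 343).  «Theorem A.4. There is a mapping `f^{es}` on the ball minus its center, `f^{es} : B − x₀ → M` (A.34),
such that a) `f^{es}|_{∂B} = f|_{∂B}` (A.35), b) `|D^α f^{es}| ≤ c_α (d(x, ∂B ∪ x₀))^{−(|α|−1)} · |x − x₀|^{−1} Λ₁(f)` (A.36).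
Proof. We define `d′ ∈ C^∞` … `½ d(x, ∂B ∪ x₀) ≤ d′(x) ≤ d(x, ∂B ∪ x₀)` (A.37) and follow the construction of subsect. C using
`f^{es′}_ε(x) = ∫ dy w^{εd′(x)}(x − y) f((y − x₀)/|y − x₀| + x₀)` (A.38) instead of (A.30). … straightforward.»
THE ROUTE FORMALISED (centre `0`, then translation): `g = radExt f` is print's 0-homogeneous integrand, `ḡ` its Lipschitz
extension from `{|y| ≥ ½}` (constant `4L_tΛ₁`), `u = smooth ε ḡ` is `f^{s′}_ε` of subsect. C (scale `εθ`), and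
`f^{es} := Pr_M ∘ u ∘ fold`; the fold (identity for `|x| ≥ ¾`, `x/(2|x|)` for `|x| ≤ ½`) realises print's scale
`εd′(x) ≍ ε·min(d(x, ∂B), |x|)` through the 0-homogeneity of the datum — below `|x| = ½` the map `x ↦ Pr_M(u(x/(2|x|)))` is
0-homogeneous like `g`, each derivative costing a factor `|x|^{−1}` (this is (A.36)); near `∂B` it is subsect. C verbatim.  ONE
construction with the least Lipschitz constant of `f` serves every admissible `Λ₁ ≤ c₁` of the capped clause.  As in
`thmA3ContCap_of_retract`, `Pr_M` enters through explicit hypotheses (the tubular-neighbourhood output: `C^∞` `P = id` on `M`,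
`P(y) ∈ M` and `‖D^iP(y)‖ ≤ C_i` for `d(y, M) < r`); the sphere targets discharge them explicitly (`PhaseCellIVThmA3Sphere`).

WHAT THIS MODULE PROVIDES (namespace `PhaseCellIVAppA.Retract`): `iteratedFDeriv_sub_const_of_pos`,
`norm_iteratedFDeriv_comp_fold_le` (chain rule through the fold with the outer map dilated by `θ(fold x)`),
`infDist_le_theta_fold_mul_norm` (`d(x, ∂B ∪ 0) ≤ (16/7)·θ(fold x)·|x|`), `thmA4_center_zero` (Theorem A.4 at `x₀ = 0`),
**`thmA4ContCap_of_retract … (n) : ThmA4ContCap n t M`**.  No `Prop`-valued definition, no named fact; axioms standard.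
-/

namespace Literature.MathematicalPhysics.QuantumFieldTheory.Federbush1986

noncomputable section

open Metric Set Filter Function Real
open scoped ContDiff Topology NNReal Nat

namespace PhaseCellIVAppA

namespace Retract

open LipschitzMollifier BallCutoffs BallSmoothing PuncturedBall

variable {n t : ℕ}

/-! ## §1 Two calculus lemmas: removing a constant; the chain rule through the fold with a dilated outer map -/

/-- Derivatives of positive order do not see an additive constant. [cite: Federbush1988PhaseCellIV, (A.36) p. 343] -/
theorem iteratedFDeriv_sub_const_of_pos {E F : Type*} [NormedAddCommGroup E] [NormedSpace ℝ E] [NormedAddCommGroup F]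
    [NormedSpace ℝ F] (g : E → F) (c : F) {i : ℕ} (hi : 1 ≤ i) (x : E) :
    iteratedFDeriv ℝ i (fun z => g z - c) x = iteratedFDeriv ℝ i g x := by
  obtain ⟨k, rfl⟩ := Nat.exists_eq_add_of_le' hi
  rw [iteratedFDeriv_succ_eq_comp_right, iteratedFDeriv_succ_eq_comp_right]
  simp only [comp_apply, fderiv_sub_const]

/-- **Chain rule through the fold, outer map dilated.**  If `u` is `C^∞` on the open unit ball, `‖D^i u(fold x)‖ ≤ a·θ₀^{−(i−1)}`
(`1 ≤ i ≤ m`, `0 < θ₀ ≤ 1`) and `‖D^i fold(x)‖ ≤ T|x|^{−i}` (`i ≤ m`, `T ≥ 1`), then `‖D^i(u ∘ fold)(x)‖ ≤ i!·(aθ₀)·(T/(θ₀|x|))^i`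
(`1 ≤ i ≤ m`): `u ∘ fold − u(fold x) = ũ ∘ (θ₀^{−1}·fold)` with `ũ(z) = u(θ₀z) − u(fold x)` FLAT at the point (`‖D^jũ‖ ≤ aθ₀`,
`j = 0` included), then Faà di Bruno with geometric weights. [cite: Federbush1988PhaseCellIV, Theorem A.4 (A.36)–(A.38) p. 343] -/
theorem norm_iteratedFDeriv_comp_fold_le {u : Euc n → Euc t} (hu : ContDiffOn ℝ ∞ u (ball (0 : Euc n) 1))
    {m : ℕ} {a θ₀ T : ℝ} (hθ₀ : 0 < θ₀) (hθ₁ : θ₀ ≤ 1) (ha : 0 ≤ a) (hT : 1 ≤ T) {x : Euc n} (hx0 : x ≠ 0)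
    (hx : x ∈ ball (0 : Euc n) 1)
    (hub : ∀ i, 1 ≤ i → i ≤ m → ‖iteratedFDeriv ℝ i u (fold x)‖ ≤ a * (θ₀⁻¹) ^ (i - 1))
    (hTb : ∀ i ≤ m, ‖iteratedFDeriv ℝ i (fold : Euc n → Euc n) x‖ ≤ T * (‖x‖⁻¹) ^ i)
    {i : ℕ} (hi1 : 1 ≤ i) (him : i ≤ m) :
    ‖iteratedFDeriv ℝ i (u ∘ fold) x‖ ≤ i ! * (a * θ₀) * (T * (θ₀ * ‖x‖)⁻¹) ^ i := by
  have h0 : 0 < ‖x‖ := norm_pos_iff.2 hx0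
  set y : Euc n := fold x with hy
  have hyb : y ∈ ball (0 : Euc n) 1 := fold_mem_ball hx0 hx
  set L : Euc n →L[ℝ] Euc n := θ₀ • ContinuousLinearMap.id ℝ (Euc n) with hL
  have hLapply : ∀ z : Euc n, L z = θ₀ • z := fun z => rfl
  -- the dilated outer function and the shrunk inner function
  set ut : Euc n → Euc t := fun z => u (L z) - u y with hut
  set ft : Euc n → Euc n := fun z => θ₀⁻¹ • fold z with hft
  set s : Set (Euc n) := ball (0 : Euc n) 1 ∩ {z | z ≠ 0} with hs_def
  have hs : IsOpen s := isOpen_ball.inter isOpen_ne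
  have hxs : x ∈ s := ⟨hx, hx0⟩
  set tt : Set (Euc n) := L ⁻¹' ball (0 : Euc n) 1 with htt
  have htt_open : IsOpen tt := isOpen_ball.preimage L.continuous
  have hcomp : ut ∘ ft = fun z => (u ∘ fold) z - u y := by
    funext z; simp only [comp_apply, hut, hft, hLapply, smul_smul, mul_inv_cancel₀ hθ₀.ne', one_smul]
  have hut_smooth : ContDiffOn ℝ ∞ ut tt :=
    (hu.comp L.contDiff.contDiffOn fun z hz => hz).sub contDiffOn_const
  have hft_smooth : ContDiffOn ℝ ∞ ft s := fun z hz => ((contDiffAt_fold hz.2).const_smul θ₀⁻¹).contDiffWithinAt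
  have hLft : ∀ z, L (ft z) = fold z := fun z => by
    show θ₀ • (θ₀⁻¹ • fold z) = fold z; rw [smul_smul, mul_inv_cancel₀ hθ₀.ne', one_smul]
  have hmaps : MapsTo ft s tt := fun z hz => by show L (ft z) ∈ ball (0 : Euc n) 1; rw [hLft]; exact fold_mem_ball hz.2 hz.1
  have hLftx : L (ft x) = y := hLft x
  have hftx_ball : L (ft x) ∈ ball (0 : Euc n) 1 := by rw [hLftx]; exact hyb
  have hLnorm : ‖L‖ ≤ θ₀ := by
    rw [hL, norm_smul, Real.norm_eq_abs, abs_of_pos hθ₀]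
    calc θ₀ * ‖ContinuousLinearMap.id ℝ (Euc n)‖ ≤ θ₀ * 1 := by gcongr; exact ContinuousLinearMap.norm_id_le
      _ = θ₀ := mul_one _
  -- (i) flat bound on the dilated outer function at `ft x`
  have hC : ∀ j ≤ i, ‖iteratedFDerivWithin ℝ j ut tt (ft x)‖ ≤ a * θ₀ := by
    intro j hj
    rw [iteratedFDerivWithin_of_isOpen j htt_open (hmaps hxs)]
    rcases Nat.eq_zero_or_pos j with rfl | hj1
    · have : ut (ft x) = 0 := by show u (L (ft x)) - u y = 0; rw [hLftx, sub_self]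
      rw [norm_iteratedFDeriv_zero, this, norm_zero]; positivity
    · have h1 : iteratedFDeriv ℝ j ut (ft x) = iteratedFDeriv ℝ j (u ∘ L) (ft x) :=
        iteratedFDeriv_sub_const_of_pos (u ∘ L) (u y) hj1 (ft x)
      have key := L.iteratedFDerivWithin_comp_right (f := u) (n := ∞) (i := j) hu isOpen_ball.uniqueDiffOn
        htt_open.uniqueDiffOn (x := ft x) hftx_ball (mod_cast le_top)
      rw [iteratedFDerivWithin_of_isOpen j htt_open (hmaps hxs), iteratedFDerivWithin_of_isOpen j isOpen_ball hftx_ball,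
        hLftx] at key
      rw [h1, key]
      calc ‖(iteratedFDeriv ℝ j u y).compContinuousLinearMap fun _ => L‖ ≤ ‖iteratedFDeriv ℝ j u y‖ * ∏ _k : Fin j, ‖L‖ :=
            ContinuousMultilinearMap.norm_compContinuousLinearMap_le _ _
        _ ≤ (a * (θ₀⁻¹) ^ (j - 1)) * θ₀ ^ j := by
            rw [show (∏ _k : Fin j, ‖L‖) = ‖L‖ ^ j by rw [Finset.prod_const, Finset.card_univ, Fintype.card_fin]]
            exact mul_le_mul (hub j hj1 (hj.trans him)) (pow_le_pow_left₀ (norm_nonneg _) hLnorm j)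
              (pow_nonneg (norm_nonneg _) _) (by positivity)
        _ = a * θ₀ := by
            obtain ⟨k, rfl⟩ := Nat.exists_eq_add_of_le' hj1
            rw [Nat.add_sub_cancel, pow_succ, inv_pow]
            field_simp
  -- (ii) geometric bound on the shrunk inner function at `x`
  have hD : ∀ j, 1 ≤ j → j ≤ i → ‖iteratedFDerivWithin ℝ j ft s x‖ ≤ (T * (θ₀ * ‖x‖)⁻¹) ^ j := by
    intro j hj1 hj
    rw [iteratedFDerivWithin_of_isOpen j hs hxs, hft,
      iteratedFDeriv_const_smul_apply' ((contDiffAt_fold hx0).of_le (mod_cast le_top)), norm_smul, norm_inv,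
      Real.norm_eq_abs, abs_of_pos hθ₀]
    calc θ₀⁻¹ * ‖iteratedFDeriv ℝ j fold x‖ ≤ θ₀⁻¹ * (T * (‖x‖⁻¹) ^ j) := by gcongr; exact hTb j (hj.trans him)
      _ ≤ (θ₀⁻¹) ^ j * (T ^ j * (‖x‖⁻¹) ^ j) := by
          apply mul_le_mul _ _ (by positivity) (by positivity)
          · exact le_self_pow₀ ((one_le_inv₀ hθ₀).2 hθ₁) (by omega)
          · exact mul_le_mul_of_nonneg_right (le_self_pow₀ hT (by omega)) (by positivity)
      _ = (T * (θ₀ * ‖x‖)⁻¹) ^ j := by rw [mul_inv, mul_pow, mul_pow, inv_pow, inv_pow]; ring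
  -- (iii) the Faà di Bruno bound
  have key := norm_iteratedFDerivWithin_comp_le hut_smooth hft_smooth (n := i) (mod_cast le_top) htt_open.uniqueDiffOn
    hs.uniqueDiffOn hmaps hxs hC hD
  rw [iteratedFDerivWithin_of_isOpen i hs hxs, hcomp, iteratedFDeriv_sub_const_of_pos _ _ hi1] at key
  exact key

/-- The geometric comparison behind (A.36)/(A.37): on the punctured open ball `d(x, ∂B ∪ 0) ≤ (16/7)·θ(fold x)·|x|`
(near `∂B` the fold is the identity and `d(x, ∂B) ≤ θ(x)`; for `|x| ≤ ¾`, `|fold x| ≤ ¾` gives `θ(fold x) ≥ 7/16` while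
`d(x, ∂B ∪ 0) ≤ |x|`). [cite: Federbush1988PhaseCellIV, (A.36)–(A.37) p. 343] -/
theorem infDist_le_theta_fold_mul_norm {x : Euc n} (hx0 : x ≠ 0) (hx : x ∈ ball (0 : Euc n) 1) :
    infDist x (sphere (0 : Euc n) 1 ∪ {0}) ≤ 16 / 7 * theta (fold x) * ‖x‖ := by
  have h0 : 0 < ‖x‖ := norm_pos_iff.2 hx0
  have hx1 : ‖x‖ < 1 := by rwa [mem_ball, dist_zero_right] at hx
  have hS : (sphere (0 : Euc n) 1).Nonempty := ⟨‖x‖⁻¹ • x, inv_norm_smul_mem_sphere hx0⟩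
  by_cases h34 : 3 / 4 ≤ ‖x‖
  · -- near the boundary: `fold x = x`, `d(x, ∂B ∪ 0) ≤ d(x, ∂B) ≤ θ(x) ≤ (16/7)θ(x)|x|`
    rw [fold_eq_self h34]
    have h1 : infDist x (sphere (0 : Euc n) 1 ∪ {0}) ≤ infDist x (sphere (0 : Euc n) 1) :=
      infDist_le_infDist_of_subset subset_union_left hS
    have h2 : infDist x (sphere (0 : Euc n) 1) ≤ theta x := infDist_sphere_le_theta (ball_subset_closedBall hx)
    have hθ : 0 < theta x := theta_pos hx
    nlinarith
  · -- inside: `d(x, ∂B ∪ 0) ≤ |x|` and `θ(fold x) ≥ 7/16`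
    rw [not_le] at h34
    have h1 : infDist x (sphere (0 : Euc n) 1 ∪ {0}) ≤ ‖x‖ := by
      simpa using infDist_le_dist_of_mem (x := x) (mem_union_right (sphere (0 : Euc n) 1) (mem_singleton (0 : Euc n)))
    have h2 : ‖fold x‖ ≤ 3 / 4 := (norm_fold_le hx0).trans (max_le (by norm_num) h34.le)
    have h3 : 7 / 16 ≤ theta (fold x) := by unfold theta; nlinarith [norm_nonneg (fold x)]
    nlinarith

/-! ## §2 Theorem A.4 at the centre `x₀ = 0` -/

/-- **Theorem A.4 at `x₀ = 0`** for a uniformly smoothly retractable target: for every cap `c₁` there are `c_m ≥ 0` such that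
every Lipschitz `f : ∂B → M` with `Λ₁(f) ≤ c₁` has `f^{es} = Pr_M ∘ f^{s′}_ε(ḡ) ∘ fold : B − 0 → M` with (A.35), continuity on
`B − 0`, smoothness inside, and (A.36) `‖D^m f^{es}(x)‖ ≤ c_m d(x, ∂B ∪ 0)^{−(m−1)} |x|^{−1} Λ₁(f)`.
[cite: Federbush1988PhaseCellIV, Theorem A.4 (A.34)–(A.38) p. 343; (A.27)–(A.31) p. 342; «Caution» p. 339] -/
theorem thmA4_center_zero {M : Set (Euc t)} {P : Euc t → Euc t} {r : ℝ} (hr : 0 < r) (hP : ContDiff ℝ ∞ P)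
    (hPM : ∀ y, infDist y M < r → P y ∈ M) (hPid : ∀ y ∈ M, P y = y)
    (hPb : ∀ i : ℕ, ∃ C : ℝ, ∀ y, infDist y M < r → ‖iteratedFDeriv ℝ i P y‖ ≤ C) (n : ℕ) (c₁ : ℝ≥0) :
    ∃ c : ℕ → ℝ, (∀ m, 0 ≤ c m) ∧ ∀ f : ↥(sphere (0 : Euc n) 1) → ↥M, (∃ K : ℝ≥0, K ≤ c₁ ∧ LipschitzWith K f) →
      ∃ fes : Euc n → Euc t,
        MapsTo fes (closedBall 0 1 \ {0}) M ∧
        (∀ x : ↥(sphere (0 : Euc n) 1), fes x = (f x : Euc t)) ∧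
        ContinuousOn fes (closedBall 0 1 \ {0}) ∧ ContDiffOn ℝ ∞ fes (ball 0 1 \ {0}) ∧
        ∀ m : ℕ, 1 ≤ m → ∀ K : ℝ≥0, K ≤ c₁ → LipschitzWith K f → ∀ x ∈ ball (0 : Euc n) 1 \ {0},
          ‖iteratedFDeriv ℝ m fes x‖ ≤ c m * ((infDist x (sphere (0 : Euc n) 1 ∪ {0}))⁻¹ ^ (m - 1)) * ‖x‖⁻¹ * K := by
  -- constants (as in subsect. C, with `Λ₁(ḡ) ≤ 4L_tΛ₁(f)`)
  set L : ℝ≥0 := 4 * lipschitzExtensionConstant (Euc t) with hL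
  set ε : ℝ := min (1 / 4) (r / (8 * (L * c₁ + 1))) with hε_def
  have hε : 0 < ε := lt_min (by norm_num) (by positivity)
  have hεr : 4 * ε * (L * c₁) < r := by
    have h1 : 4 * ε * (L * c₁) ≤ 4 * (r / (8 * (L * c₁ + 1))) * (L * c₁) := by gcongr; exact min_le_right _ _
    have h2 : 4 * (r / (8 * (L * c₁ + 1))) * (L * c₁) = r / 2 * (L * c₁ / (L * c₁ + 1)) := by field_simp; ring
    have h3 : (L * c₁ : ℝ) / (L * c₁ + 1) < 1 := (div_lt_one (by positivity)).2 (lt_add_one _)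
    nlinarith [mul_nonneg L.coe_nonneg c₁.coe_nonneg]
  have hA : ∀ m : ℕ, ∃ A : ℝ, 0 ≤ A ∧ ∀ (g : Euc n → Euc t) (K : ℝ≥0), LipschitzWith K g → ∀ i, 1 ≤ i → i ≤ m →
      ∀ x ∈ ball (0 : Euc n) 1, ‖iteratedFDeriv ℝ i (smooth ε g) x‖ ≤ A * K * ((theta x)⁻¹) ^ (i - 1) :=
    fun m => exists_deriv_bound m hε
  choose A hA0 hA using hA
  choose Cf hCf using hPb
  set Cmax : ℕ → ℝ := fun m => ∑ i ∈ Finset.range (m + 1), max (Cf i) 0 with hCmax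
  have hCmax_ge : ∀ m i, i ≤ m → Cf i ≤ Cmax m := fun m i hi =>
    (le_max_left _ _).trans (Finset.single_le_sum (f := fun i => max (Cf i) 0) (fun i _ => le_max_right _ _)
      (by rw [Finset.mem_range]; omega))
  have hCmax0 : ∀ m, 0 ≤ Cmax m := fun m => Finset.sum_nonneg fun i _ => le_max_right _ _
  have hTf : ∀ i : ℕ, ∃ T : ℝ, 0 ≤ T ∧ ∀ x : Euc n, x ≠ 0 → ‖x‖ ≤ 1 →
      ‖iteratedFDeriv ℝ i (fold : Euc n → Euc n) x‖ ≤ T * (‖x‖⁻¹) ^ i := fun i => exists_fold_bound i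
  choose Tf hTf0 hTf using hTf
  set Tm : ℕ → ℝ := fun m => max 1 (∑ i ∈ Finset.range (m + 1), Tf i) with hTm
  have hTm1 : ∀ m, 1 ≤ Tm m := fun m => le_max_left _ _
  have hTm_ge : ∀ m i, i ≤ m → Tf i ≤ Tm m := fun m i hi =>
    (Finset.single_le_sum (f := Tf) (fun i _ => hTf0 i) (by rw [Finset.mem_range]; omega)).trans (le_max_right _ _)
  set U : ℕ → ℝ := fun m => max 1 (m ! * A m * (L * c₁)) with hU
  have hU1 : ∀ m, 1 ≤ U m := fun m => le_max_left _ _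
  refine ⟨fun m => m ! * Cmax m * U m ^ (m - 1) * (m ! * A m * Tm m ^ m) * (16 / 7) ^ (m - 1) * L,
    fun m => by have := hA0 m; have := hCmax0 m; have := hU1 m; have := hTm1 m; positivity, fun f hf => ?_⟩
  obtain ⟨K₀, hK₀c, hK₀⟩ := hf
  -- the least Lipschitz constant of `f`
  set Ks : ℝ≥0 := sInf {K : ℝ≥0 | LipschitzWith K f} with hKs
  have hKs_lip : LipschitzWith Ks f := lipschitzWith_sInf hK₀
  have hKs_le : ∀ K : ℝ≥0, LipschitzWith K f → Ks ≤ K := fun K hK => sInf_lipschitz_le hK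
  have hKsc : Ks ≤ c₁ := (hKs_le K₀ hK₀).trans hK₀c
  -- `ḡ`: Lipschitz extension of the 0-homogeneous extension from `{|y| ≥ ½}`; `u = f^{s′}_ε(ḡ)`; `f^{es} = P ∘ u ∘ fold`
  obtain ⟨g, hgL, hgeq⟩ := (lipschitzOnWith_radExt hKs_lip).extend_finite_dimension
  have hgL' : LipschitzWith (L * Ks) g := hgL.weaken (le_of_eq (by rw [hL]; ring))
  set u : Euc n → Euc t := smooth ε g with hu
  have hclose : ∀ y ∈ closedBall (0 : Euc n) 1, 1 / 2 ≤ ‖y‖ → infDist (u y) M < r := by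
    intro y hy hy2
    have hy0 : y ≠ 0 := by intro h; rw [h, norm_zero] at hy2; linarith
    have hgy : g y ∈ M := by rw [← hgeq (show y ∈ {y : Euc n | 1 / 2 ≤ ‖y‖} from hy2)]; exact radExt_mem f hy0
    have h1 : infDist (u y) M ≤ dist (u y) (g y) := infDist_le_dist_of_mem hgy
    have h2 : dist (u y) (g y) ≤ 4 * ε * (L * Ks) * max (theta y) 0 := by
      rw [dist_eq_norm]; exact norm_smooth_sub_le' hε hgL' y
    have h3 : max (theta y) 0 ≤ 1 := max_le (theta_le_one y) zero_le_one
    have h4 : 4 * ε * ((L : ℝ) * Ks) * max (theta y) 0 ≤ 4 * ε * (L * c₁) * 1 := by gcongr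
    linarith
  have hclose' : ∀ x ∈ closedBall (0 : Euc n) 1, x ≠ 0 → infDist (u (fold x)) M < r := fun x hx hx0 =>
    hclose _ (fold_mem_closedBall hx0 hx) (half_le_norm_fold hx0)
  have hne : ∀ {x : Euc n} {S : Set (Euc n)}, x ∈ S \ {0} → x ≠ 0 := fun hx h => hx.2 (by rw [h]; exact mem_singleton 0)
  have hPu_cont : Continuous (P ∘ u) := hP.continuous.comp (continuous_smooth hε hgL')
  have hPu_smooth : ContDiffOn ℝ ∞ (P ∘ u) (ball (0 : Euc n) 1) := hP.comp_contDiffOn (contDiffOn_smooth hgL'.continuous)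
  refine ⟨P ∘ u ∘ fold, fun x hx => hPM _ (hclose' x hx.1 (hne hx)), fun x => ?_, ?_, ?_, fun m hm K hKc hK x hx => ?_⟩
  · -- (A.35) boundary values: `fold = id`, `u = ḡ = g = f` on `∂B`, `P = id` on `M`
    have hx1 : ‖(x : Euc n)‖ = 1 := by have := x.2; rwa [mem_sphere, dist_zero_right] at this
    show P (u (fold (x : Euc n))) = _
    rw [fold_eq_self (by rw [hx1]; norm_num), hu, smooth_eq_on_sphere x.2,
      ← hgeq (show (x : Euc n) ∈ {y : Euc n | 1 / 2 ≤ ‖y‖} by simp only [mem_setOf_eq, hx1]; norm_num),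
      radExt_eq_of_mem_sphere f x.2]
    exact hPid _ (f _).2
  · -- continuity on `B − 0`
    exact hPu_cont.comp_continuousOn (continuousOn_fold.mono fun x hx => hne hx)
  · -- smoothness on the open punctured ball
    exact hPu_smooth.comp (contDiffOn_fold.mono fun x hx => hne hx) fun x hx => fold_mem_ball (hne hx) hx.1
  · -- (A.36)
    have hx0 : x ≠ 0 := hne hx
    have hxb : x ∈ ball (0 : Euc n) 1 := hx.1
    have h0 : 0 < ‖x‖ := norm_pos_iff.2 hx0
    have hx1 : ‖x‖ ≤ 1 := by have := hxb; rw [mem_ball, dist_zero_right] at this; exact this.le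
    set y : Euc n := fold x with hy
    have hyb : y ∈ ball (0 : Euc n) 1 := fold_mem_ball hx0 hxb
    have hθ₀ : 0 < theta y := theta_pos hyb
    have hθ₁ : theta y ≤ 1 := theta_le_one y
    -- the open punctured ball and `Φ = u ∘ fold`
    set s : Set (Euc n) := ball (0 : Euc n) 1 ∩ {z | z ≠ 0} with hs_def
    have hs : IsOpen s := isOpen_ball.inter isOpen_ne
    have hxs : x ∈ s := ⟨hxb, hx0⟩
    have hΦ : ContDiffOn ℝ ∞ (u ∘ fold) s :=
      (contDiffOn_smooth hgL'.continuous).comp (contDiffOn_fold.mono fun z hz => hz.2) fun z hz => fold_mem_ball hz.2 hz.1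
    -- derivative bounds of `Φ` at `x` (chain rule through the fold)
    have hub : ∀ i, 1 ≤ i → i ≤ m → ‖iteratedFDeriv ℝ i u y‖ ≤ A m * (L * Ks) * ((theta y)⁻¹) ^ (i - 1) :=
      fun i hi1 him => hA m g (L * Ks) hgL' i hi1 him y hyb
    have hTb : ∀ i ≤ m, ‖iteratedFDeriv ℝ i (fold : Euc n → Euc n) x‖ ≤ Tm m * (‖x‖⁻¹) ^ i := fun i hi =>
      (hTf i x hx0 hx1).trans (mul_le_mul_of_nonneg_right (hTm_ge m i hi) (by positivity))
    have ha0 : 0 ≤ A m * (L * Ks) := by have := hA0 m; positivity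
    set W : ℝ := (theta y * ‖x‖)⁻¹ with hW
    have hW0 : 0 < W := by positivity
    have hΦb : ∀ i, 1 ≤ i → i ≤ m →
        ‖iteratedFDeriv ℝ i (u ∘ fold) x‖ ≤ (m ! * (A m * (L * Ks)) * theta y) * ((Tm m * W)⁻¹)⁻¹ ^ i := by
      intro i hi1 him
      rw [inv_inv]
      refine (norm_iteratedFDeriv_comp_fold_le (contDiffOn_smooth hgL'.continuous) hθ₀ hθ₁ ha0 (hTm1 m) hx0 hxb hub hTb
        hi1 him).trans ?_
      have : (i ! : ℝ) ≤ m ! := by exact_mod_cast Nat.factorial_le him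
      have hθA : 0 ≤ A m * (L * Ks) * theta y := by positivity
      calc (i ! : ℝ) * (A m * (L * Ks) * theta y) * (Tm m * W) ^ i ≤ m ! * (A m * (L * Ks) * theta y) * (Tm m * W) ^ i := by
            gcongr
        _ = m ! * (A m * (L * Ks)) * theta y * (Tm m * W) ^ i := by ring
    -- the `Pr_M` step, linear in `Λ₁`
    have hPt : ∀ i ≤ m, ‖iteratedFDeriv ℝ i P ((u ∘ fold) x)‖ ≤ Cmax m := fun i hi =>
      (hCf i _ (hclose' x (ball_subset_closedBall hxb) hx0)).trans (hCmax_ge m i hi)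
    have hu0 : 0 ≤ m ! * (A m * (L * Ks)) * theta y := by positivity
    have huU : m ! * (A m * (L * Ks)) * theta y ≤ U m := by
      refine le_trans ?_ (le_max_right _ _)
      calc (m ! : ℝ) * (A m * (L * Ks)) * theta y ≤ m ! * (A m * (L * c₁)) * 1 := by
            have := hA0 m; gcongr
        _ = m ! * A m * (L * c₁) := by ring
    have key := norm_iteratedFDeriv_comp_le_of_scale hs hxs hΦ hP hm (σ := (Tm m * W)⁻¹) (by positivity) hu0 huU (hU1 m)
      hPt hΦb
    rw [inv_inv] at key
    -- geometry: `W ≤ (16/7)/d(x, ∂B ∪ 0)` and `θ(y)·W = |x|^{−1}`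
    have hδ : 0 < infDist x (sphere (0 : Euc n) 1 ∪ {0}) := by
      refine ((isClosed_sphere.union isClosed_singleton).notMem_iff_infDist_pos ⟨0, mem_union_right _ (mem_singleton 0)⟩).1 ?_
      rintro (h | h)
      · rw [mem_sphere, dist_zero_right] at h; rw [mem_ball, dist_zero_right] at hxb; exact absurd h (ne_of_lt hxb)
      · exact hx0 h
    have hWδ : W ≤ 16 / 7 * (infDist x (sphere (0 : Euc n) 1 ∪ {0}))⁻¹ := by
      rw [hW, ← div_eq_mul_inv, le_div_iff₀ hδ, inv_mul_le_iff₀ (by positivity)]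
      have := infDist_le_theta_fold_mul_norm hx0 hxb
      linarith
    have hθW : theta y * W ^ m = W ^ (m - 1) * ‖x‖⁻¹ := by
      obtain ⟨k, rfl⟩ := Nat.exists_eq_add_of_le' hm
      have hθne : theta y ≠ 0 := hθ₀.ne'
      have hxne : ‖x‖ ≠ 0 := h0.ne'
      rw [Nat.add_sub_cancel, pow_succ, hW, mul_inv]
      field_simp
    have hc0 : 0 ≤ (m ! : ℝ) * Cmax m * U m ^ (m - 1) * (m ! * A m * Tm m ^ m) := by
      have := hA0 m; have := hCmax0 m; have := hU1 m; have := hTm1 m; positivity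
    have h1 : (L : ℝ) * Ks ≤ L * K := mul_le_mul_of_nonneg_left (NNReal.coe_le_coe.2 (hKs_le K hK)) L.coe_nonneg
    have hmain : (L : ℝ) * Ks * (theta y * W ^ m) ≤
        L * K * ((16 / 7 * (infDist x (sphere (0 : Euc n) 1 ∪ {0}))⁻¹) ^ (m - 1) * ‖x‖⁻¹) := by
      rw [hθW]
      exact mul_le_mul h1 (mul_le_mul_of_nonneg_right (pow_le_pow_left₀ hW0.le hWδ _) (by positivity)) (by positivity)
        ((by positivity : 0 ≤ (L : ℝ) * Ks).trans h1)
    calc ‖iteratedFDeriv ℝ m (P ∘ u ∘ fold) x‖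
        ≤ m ! * Cmax m * U m ^ (m - 1) * (m ! * (A m * (L * Ks)) * theta y) * (Tm m * W) ^ m := key
      _ = m ! * Cmax m * U m ^ (m - 1) * (m ! * A m * Tm m ^ m) * ((L * Ks) * (theta y * W ^ m)) := by rw [mul_pow]; ring
      _ ≤ m ! * Cmax m * U m ^ (m - 1) * (m ! * A m * Tm m ^ m) *
            ((L * K) * ((16 / 7 * (infDist x (sphere (0 : Euc n) 1 ∪ {0}))⁻¹) ^ (m - 1) * ‖x‖⁻¹)) :=
          mul_le_mul_of_nonneg_left hmain hc0
      _ = m ! * Cmax m * U m ^ (m - 1) * (m ! * A m * Tm m ^ m) * (16 / 7) ^ (m - 1) * L *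
            ((infDist x (sphere (0 : Euc n) 1 ∪ {0}))⁻¹ ^ (m - 1)) * ‖x‖⁻¹ * K := by rw [mul_pow]; ring

/-! ## §3 Theorem A.4 (capped form) for uniformly smoothly retractable targets -/

/-- **Theorem A.4 of [Federbush1988PhaseCellIV] (decl of record `ThmA4ContCap`, with the printed continuity on `B − x₀` and
the p. 339 «Caution» cap) for every target `M ⊆ R^t` that is a uniform smooth neighbourhood retract**: given `r > 0` and a
`C^∞` map `P` with `P(y) ∈ M` for `d(y, M) < r`, `P = id` on `M`, `‖D^iP‖ ≤ C_i` on `{d(·, M) < r}` (print's `Pr_M`; for a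
compact `C^∞` submanifold the tubular-neighbourhood theorem), for every cap `c₁` there are constants `c_m` such that for every
centre `x₀` and every Lipschitz `f : ∂B → M` (`B = {|x − x₀| ≤ 1}`, `Λ₁(f) ≤ c₁`) there is `f^{es} : B − x₀ → M`, continuous,
`C^∞` on the open punctured ball, `f^{es} = f` on `∂B` (A.35), with
(A.36) `‖D^m f^{es}(x)‖ ≤ c_m d(x, ∂B ∪ x₀)^{−(m−1)} |x − x₀|^{−1} Λ₁(f)`.  Reduction to `x₀ = 0` by translation.
[cite: Federbush1988PhaseCellIV, Theorem A.4 (A.32)–(A.38) p. 342–343; «Caution» p. 339] -/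
theorem thmA4ContCap_of_retract {M : Set (EuclideanSpace ℝ (Fin t))} {P : EuclideanSpace ℝ (Fin t) → EuclideanSpace ℝ (Fin t)}
    {r : ℝ} (hr : 0 < r) (hP : ContDiff ℝ ∞ P) (hPM : ∀ y, infDist y M < r → P y ∈ M) (hPid : ∀ y ∈ M, P y = y)
    (hPb : ∀ i : ℕ, ∃ C : ℝ, ∀ y, infDist y M < r → ‖iteratedFDeriv ℝ i P y‖ ≤ C) (n : ℕ) :
    ThmA4ContCap n t M := by
  intro c₁
  obtain ⟨c, hc0, hc⟩ := thmA4_center_zero hr hP hPM hPid hPb n c₁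
  refine ⟨c, fun x₀ f hf => ?_⟩
  -- transport the datum to the unit sphere at the origin
  have hmem : ∀ y : Euc n, y ∈ sphere (0 : Euc n) 1 → x₀ + y ∈ sphere x₀ 1 := fun y hy => by
    rw [mem_sphere, dist_eq_norm, add_sub_cancel_left]; rwa [mem_sphere, dist_zero_right] at hy
  set f₀ : ↥(sphere (0 : Euc n) 1) → ↥M := fun y => f ⟨x₀ + y, hmem y y.2⟩ with hf₀
  have hlip : ∀ K : ℝ≥0, LipschitzWith K f → LipschitzWith K f₀ := fun K hK =>
    LipschitzWith.of_dist_le_mul fun a b => by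
      have := hK.dist_le_mul ⟨x₀ + a, hmem a a.2⟩ ⟨x₀ + b, hmem b b.2⟩
      simpa [hf₀, Subtype.dist_eq] using this
  obtain ⟨K₀, hK₀c, hK₀⟩ := hf
  obtain ⟨fes₀, h1, h2, h3, h4, h5⟩ := hc f₀ ⟨K₀, hK₀c, hlip K₀ hK₀⟩
  have hshift : ∀ {x : Euc n} {S : Set (Euc n)}, x ∈ S \ {x₀} → x - x₀ ≠ 0 := fun hx h =>
    hx.2 (by rw [sub_eq_zero.1 h]; exact mem_singleton x₀)
  have hmaps_c : MapsTo (fun x : Euc n => x - x₀) (closedBall x₀ 1 \ {x₀}) (closedBall 0 1 \ {0}) := fun x hx =>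
    ⟨by rw [mem_closedBall, dist_zero_right, ← dist_eq_norm]; exact hx.1, fun h => hshift hx h⟩
  have hmaps_b : MapsTo (fun x : Euc n => x - x₀) (ball x₀ 1 \ {x₀}) (ball 0 1 \ {0}) := fun x hx =>
    ⟨by rw [mem_ball, dist_zero_right, ← dist_eq_norm]; exact hx.1, fun h => hshift hx h⟩
  refine ⟨fun x => fes₀ (x - x₀), fun x hx => h1 (hmaps_c hx), fun x => ?_, ?_, ?_, fun m hm K hKc hK x hx => ?_⟩
  · -- (A.35)
    have hxs : (x : Euc n) - x₀ ∈ sphere (0 : Euc n) 1 := by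
      have := x.2; rw [mem_sphere, dist_eq_norm] at this; rwa [mem_sphere, dist_zero_right]
    show fes₀ ((x : Euc n) - x₀) = _
    rw [h2 ⟨(x : Euc n) - x₀, hxs⟩, hf₀]
    exact congrArg Subtype.val (congrArg f (Subtype.ext (add_sub_cancel x₀ (x : Euc n))))
  · exact h3.comp (continuous_id.sub continuous_const).continuousOn hmaps_c
  · exact h4.comp (contDiff_id.sub contDiff_const).contDiffOn hmaps_b
  · -- (A.36): derivatives commute with the translation, distances are invariant
    rw [iteratedFDeriv_comp_sub]
    have hx' : x - x₀ ∈ ball (0 : Euc n) 1 \ {0} := hmaps_b hx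
    refine (h5 m hm K hKc (hlip K hK) (x - x₀) hx').trans ?_
    -- compare the two distances: `d(x, ∂B ∪ x₀) ≤ d(x − x₀, ∂B₀ ∪ 0)`
    have hle : infDist x (sphere x₀ 1 ∪ {x₀}) ≤ infDist (x - x₀) (sphere (0 : Euc n) 1 ∪ {0}) := by
      refine (le_infDist ⟨0, mem_union_right _ (mem_singleton 0)⟩).2 fun w hw => ?_
      have hw' : x₀ + w ∈ sphere x₀ 1 ∪ {x₀} := by
        rcases hw with hw | hw
        · exact mem_union_left _ (hmem w hw)
        · rw [mem_singleton_iff.1 hw, add_zero]; exact mem_union_right _ (mem_singleton x₀)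
      refine (infDist_le_dist_of_mem hw').trans_eq ?_
      rw [dist_eq_norm, dist_eq_norm]; congr 1; abel
    have hδ : 0 < infDist x (sphere x₀ 1 ∪ {x₀}) := by
      refine ((isClosed_sphere.union isClosed_singleton).notMem_iff_infDist_pos ⟨x₀, mem_union_right _ (mem_singleton x₀)⟩).1 ?_
      rintro (h | h)
      · have h' := hx.1; rw [mem_ball] at h'; rw [mem_sphere] at h; exact absurd h (ne_of_lt h')
      · exact hx.2 h
    exact mul_le_mul_of_nonneg_right (mul_le_mul_of_nonneg_right (mul_le_mul_of_nonneg_left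
      (pow_le_pow_left₀ (inv_nonneg.2 infDist_nonneg) ((inv_le_inv₀ (hδ.trans_le hle) hδ).2 hle) _) (hc0 m))
      (inv_nonneg.2 (norm_nonneg _))) K.coe_nonneg

end Retract

end PhaseCellIVAppA

end

end Literature.MathematicalPhysics.QuantumFieldTheory.Federbush1986
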